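/-
Copyright: the b2b-balaban T⁴-continuum CRUX team, row NE7b OWNER lineage `t4-ne7b-p1` (gen 128). Project licence.
-/
import Summits.QuantumFields.BalabanUV.T4Continuum.Spine.NE7b.SupRegulatorRenormalised

/-!
# THE REGULATOR FLOW ALONG THE SCALES: integrating a regulated functional successively against centred Gaussians `N(0,Γ_0), N(0,Γ_1), …`
# (`Γ_j ⪯ γ_j·1`) keeps it regulated with the SAME matrix regulator grown by the margins — after `n` steps
# `‖K_n(φ)‖ ≤ A·Π_{j<n}(1−θ_j)^{−c_j·tr(MΓ_j)∕(2θ_j)} · e^{½c_nφᵀMφ}`, `c_n = Π_{j<n}(1−θ_j)⁻¹`, provided each step is subcritical for the grown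
# regulator (`c_jκγ_j ≤ θ_j < 1`) — (295)'s one-step bound `M ↦ (1−θ)⁻¹M` iterated (row NE7b, node U5c; (295) BY NAME + induction; [folklore])

Cell `pub-balaban`, sub-cell `t4`, spine estimate NE7b (`T4WeightBudget.RelWeightBound`; the cell's OWN estimate — NOT PRINTED in
[Bałaban 1983–89], NOT PROVED).  Crux-route work under `Spine/NE7b/` by the row OWNER (`t4-ne7b-p1` gen 128, file (301)) under FREEZE
(0)'s crux-prover clause, on § [NE7bP1-G127-HANDOFF] NEXT (3)(b)∕(e) (towards the iteration); NOTHING of Bałaban's is named as a Lean object,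
valued or asserted; no `T4Continuum/Support` leaf typed; no `def`, no notation; zero `sorry`.  Imports (BY NAME): the OWNER's (295)
`…SupRegulatorRenormalised` (`regulated_convolution_le`), Mathlib's `Finset.prod_range_succ`, `Matrix.trace_smul`.

WHY (located).  The multiscale use of (F) «activities are regulated functionals of the external field» is an INDUCTION along (280)'s
convolution of scales: the output of step `j` (regulated with `c_jM`) is the input of step `j+1`, whose Gaussian `N(0,Γ_{j+1})` must be
subcritical for `c_jM`.  This file types the induction abstractly for any sequence `K_{j+1}(φ) = ∫K_j(x+φ)dN(0,Γ_j)(x)`: the regulator never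
changes shape, its strength grows by `(1−θ_j)⁻¹` per step and the prefactor by `(1−θ_j)^{−c_j tr(MΓ_j)∕(2θ_j)}` — so with `θ_j` summable
(e.g. `θ_j ∝ κ·K_j`, `K_j = O(4^{−j})` by (284)) both products converge: the regulated class is STABLE along the whole flow.

WHAT IS PROVED ([folklore]):
* §1 bookkeeping: `smul_regulator_bounds` (`c ≥ 0`, `0 ⪯ M ⪯ κ·1` ⟹ `0 ⪯ cM ⪯ (cκ)·1`), `smul_form` (`xᵀ(cM)x = c·xᵀMx`),
  `trace_smul_mul` (`tr((cM)Γ) = c·tr(MΓ)`);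
* §2 THE END **`regulator_flow`** (the displayed bound for every `n` and every `φ`, by induction on `n` from (295));
  `regulator_flow_prefactor_nonneg`; §3 toy.

HONEST (what this is NOT).  An abstract induction on a sequence of convolutions; the identification `K_n(φ) = ∫K_0(x+φ)dN(0,Σ_{j<n}Γ_j)`
(the tree's Gaussian convolution lemma + Fubini, (280)'s `scale_peel`) and the cell∕polymer structure are not re-typed here; the factors of
the road are re-expanded at each scale (the true RG step), which this flow does not do; scalar skeleton ((A3), NC-NE7b-α UNRULED); nothing of
Bałaban's asserted.  BY-NAME EFFECT ON THE WALL: NONE.  NE7b NOT PRINTED ∕ NOT PROVED; spine PROVED 0∕9; rung (B)+1 — the programme's measures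
remain FINITE-torus statements; NOT the mass gap, NOT Clay.  HONEST DEPENDENCY: continuum YM on T⁴ ⇐ BetaPertH ∧ nine spine estimates (0∕9
proved); BetaPertH ⇐ (D1) ∧ (D4) ∧ CAP+tail; G-an2-4 gates asym, D1 and NE2∕3∕4.
-/

set_option autoImplicit false

noncomputable section

namespace Summit.QuantumFields.BalabanUV.T4Continuum.NE7b.SupRegulatorFlow

open MeasureTheory ProbabilityTheory Matrix Real WithLp Finset
open scoped BigOperators
open SupRegulatorRenormalised (regulated_convolution_le)

variable {ι : Type*} [Fintype ι] [DecidableEq ι]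

/-! ## §1. Scaling a regulator -/

omit [Fintype ι] in
/-- **SCALED REGULATOR BOUNDS**: `c ≥ 0`, `0 ⪯ M ⪯ κ·1` ⟹ `0 ⪯ cM` and `(cκ)·1 − cM ⪰ 0`. [folklore] -/
theorem smul_regulator_bounds {M : Matrix ι ι ℝ} {κ c : ℝ} (hM : M.PosSemidef) (hMκ : (κ • (1 : Matrix ι ι ℝ) - M).PosSemidef)
    (hc : 0 ≤ c) : (c • M).PosSemidef ∧ ((c * κ) • (1 : Matrix ι ι ℝ) - c • M).PosSemidef := by
  refine ⟨hM.smul hc, ?_⟩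
  have h := hMκ.smul hc
  rwa [smul_sub, smul_smul] at h

omit [DecidableEq ι] in
/-- `xᵀ(cM)x = c·xᵀMx`. [folklore] -/
theorem smul_form (M : Matrix ι ι ℝ) (c : ℝ) (x : ι → ℝ) : x ⬝ᵥ (c • M) *ᵥ x = c * (x ⬝ᵥ M *ᵥ x) := by
  rw [smul_mulVec, dotProduct_smul, smul_eq_mul]

omit [DecidableEq ι] in
/-- `tr((cM)Γ) = c·tr(MΓ)`. [folklore] -/
theorem trace_smul_mul (M Γ : Matrix ι ι ℝ) (c : ℝ) : (c • M * Γ).trace = c * (M * Γ).trace := by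
  rw [smul_mul, trace_smul, smul_eq_mul]

/-! ## §2. THE END: the flow -/

/-- **THE REGULATOR FLOW ALONG THE SCALES.**  Covariances `Γ_j ⪰ 0` with `Γ_j ⪯ γ_j·1` (`γ_j ≥ 0`); a regulator `0 ⪯ M ⪯ κ·1` (`κ ≥ 0`);
margins `0 < θ_j < 1` with the GROWN subcriticality `(Π_{i<j}(1−θ_i)⁻¹)·κ·γ_j ≤ θ_j` at every step; a sequence of functionals with
`‖K_0(x)‖ ≤ A·e^{½xᵀMx}` (`A ≥ 0`) and `K_{j+1}(φ) = ∫K_j(x+φ) dN(0,Γ_j)(x)` ⟹ for every `n` and every `φ`: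
`‖K_n(φ)‖ ≤ A·Π_{j<n}(1−θ_j)^{−(c_j·tr(MΓ_j))∕(2θ_j)} · e^{½c_n·φᵀMφ}`, `c_j = Π_{i<j}(1−θ_i)⁻¹`. [folklore] -/
theorem regulator_flow {E : Type*} [NormedAddCommGroup E] [NormedSpace ℝ E] (Γ : ℕ → Matrix ι ι ℝ) (γ θ : ℕ → ℝ)
    {M : Matrix ι ι ℝ} {κ A : ℝ} (hΓ : ∀ j, (Γ j).PosSemidef) (hΓop : ∀ j, (γ j • (1 : Matrix ι ι ℝ) - Γ j).PosSemidef)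
    (hγ : ∀ j, 0 ≤ γ j) (hM : M.PosSemidef) (hMκ : (κ • (1 : Matrix ι ι ℝ) - M).PosSemidef) (hκ : 0 ≤ κ) (hθ0 : ∀ j, 0 < θ j)
    (hθ1 : ∀ j, θ j < 1) (hA : 0 ≤ A) (hsub : ∀ j, (∏ i ∈ range j, (1 - θ i)⁻¹) * κ * γ j ≤ θ j) (K : ℕ → (ι → ℝ) → E)
    (hK0 : ∀ x, ‖K 0 x‖ ≤ A * exp ((x ⬝ᵥ M *ᵥ x) / 2))
    (hstep : ∀ j φ, K (j + 1) φ = ∫ x, K j (ofLp x + φ) ∂(multivariateGaussian 0 (Γ j))) :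
    ∀ n φ, ‖K n φ‖ ≤
      (A * ∏ j ∈ range n, (1 - θ j) ^ (-(((∏ i ∈ range j, (1 - θ i)⁻¹) * (M * Γ j).trace) / (2 * θ j)))) *
        exp (((∏ j ∈ range n, (1 - θ j)⁻¹) * (φ ⬝ᵥ M *ᵥ φ)) / 2) := by
  -- positivity of the growth factors
  have hcpos : ∀ n, 0 < ∏ i ∈ range n, (1 - θ i)⁻¹ := fun n =>
    prod_pos fun i _ => inv_pos.2 (by linarith [hθ1 i])
  have hApos : ∀ n, 0 ≤ A * ∏ j ∈ range n, (1 - θ j) ^ (-(((∏ i ∈ range j, (1 - θ i)⁻¹) * (M * Γ j).trace) / (2 * θ j))) :=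
    fun n => mul_nonneg hA (prod_nonneg fun j _ => rpow_nonneg (by linarith [hθ1 j]) _)
  intro n
  induction n with
  | zero =>
      intro φ
      simpa using hK0 φ
  | succ n ih =>
      intro φ
      -- the input of step `n` is regulated with the matrix `c_n • M`, `c_n = Π_{i<n}(1−θ_i)⁻¹`
      obtain ⟨hcM, hcMκ⟩ := smul_regulator_bounds (c := ∏ i ∈ range n, (1 - θ i)⁻¹) hM hMκ (hcpos n).le
      have hKn : ∀ x, ‖K n x‖ ≤
          (A * ∏ j ∈ range n, (1 - θ j) ^ (-(((∏ i ∈ range j, (1 - θ i)⁻¹) * (M * Γ j).trace) / (2 * θ j)))) *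
            exp ((x ⬝ᵥ ((∏ i ∈ range n, (1 - θ i)⁻¹) • M) *ᵥ x) / 2) := fun x => by
        rw [smul_form]; exact ih x
      have hκ' : 0 ≤ (∏ i ∈ range n, (1 - θ i)⁻¹) * κ := mul_nonneg (hcpos n).le hκ
      have h := regulated_convolution_le (hΓ n) (hΓop n) (hγ n) hcM hcMκ hκ' (hθ0 n) (hθ1 n) (hsub n) (hApos n) hKn φ
      rw [hstep n φ]
      refine h.trans (le_of_eq ?_)
      -- bookkeeping: `tr((cM)Γ_n) = c·tr(MΓ_n)`, `(1−θ_n)⁻¹·c_n = c_{n+1}`, `A_n·(…) = A_{n+1}`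
      rw [trace_smul_mul, smul_form, prod_range_succ, prod_range_succ]
      congr 1
      · ring
      · congr 1
        ring

omit [DecidableEq ι] in
/-- The flow's prefactors are nonnegative (for `A ≥ 0`). [folklore] -/
theorem regulator_flow_prefactor_nonneg (Γ : ℕ → Matrix ι ι ℝ) (θ : ℕ → ℝ) (M : Matrix ι ι ℝ) {A : ℝ} (hA : 0 ≤ A)
    (hθ1 : ∀ j, θ j < 1) (n : ℕ) :
    0 ≤ A * ∏ j ∈ range n, (1 - θ j) ^ (-(((∏ i ∈ range j, (1 - θ i)⁻¹) * (M * Γ j).trace) / (2 * θ j))) :=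
  mul_nonneg hA (prod_nonneg fun j _ => rpow_nonneg (by linarith [hθ1 j]) _)

/-! ## §3. Toy -/

/-- Toy (§1): scaling the zero regulator keeps it zero-bounded: `0 ⪯ c·0 ⪯ (c·κ)·1` for `c, κ ≥ 0`. -/
example (c κ : ℝ) (hc : 0 ≤ c) (hκ : 0 ≤ κ) :
    (c • (0 : Matrix (Fin 2) (Fin 2) ℝ)).PosSemidef ∧ ((c * κ) • (1 : Matrix (Fin 2) (Fin 2) ℝ) - c • (0 : Matrix (Fin 2) (Fin 2) ℝ)).PosSemidef :=
  smul_regulator_bounds Matrix.PosSemidef.zero (by rw [sub_zero]; exact Matrix.PosSemidef.one.smul hκ) hc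

end Summit.QuantumFields.BalabanUV.T4Continuum.NE7b.SupRegulatorFlow
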